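import Literature.AlgebraicGeometry.Motives.StandardConjectureDKunnethFullyAlgebraicFactor
import Literature.AlgebraicGeometry.Motives.TateConjectureKunnethFullyAlgebraicFactor
import Literature.AlgebraicGeometry.Motives.KunnethFormulaBettiNumbers
import HarnessLib

/-!
# Factors with fully algebraic cohomology on either side and iterated:
# `D(Z × X) ⟺ D(X)`, `D((X × Z₁) × Z₂) ⟺ D(X) ⟺ D(X × (Z₁ × Z₂))`, `Tᶜ(Z × X)`, `Tᶜ((X × Z₁) × Z₂)`,
# `D(𝐏ʳ × X) ⟺ D(X)`, `Tᶜ(𝐏ʳ × X)`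

Topic `Literature/AlgebraicGeometry/Motives`; THEOREMS ONLY (no definition, no instance, no named fact;
D-0026).

Rows g53-#2 and g53-#7 transported Tate's conjecture `Tᶜ` (`tateConjectureFor_tensor_iff`) and the standard
conjecture `D` (`standardConjectureD_tensor_iff`) along a right-hand factor `Z` with fully algebraic cohomology
(`K·A^q(Z) = H^{2q}(Z)` for all `q`, `b_{odd}(Z) = 0`).  This file records the bookkeeping consequences:

* §1 (any `W`) **`D` is invariant under isomorphisms** (`standardConjectureD_of_iso`, `standardConjectureD_iff_of_iso`:
  `e^*` is injective, Kleiman's descent `standardConjectureD_of_pullback_injective` with `r = 0`), hence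
  **`D(X × Z) ⟺ D(Z × X)`** (`standardConjectureD_tensor_comm`, braiding) and **`D(Z × X) ⟺ D(X)`** for `Z`
  with fully algebraic cohomology (`standardConjectureD_tensor_iff_left`).
* §2 (any `W`) **iterated products**: the class «fully algebraic cohomology, no odd cohomology» is closed under
  products (row g53-#1 `algebraicClasses_tensor_eq_top`, `finrank_obj_tensor_eq_zero_of_odd`), so
  **`D((X × Z₁) × Z₂) ⟺ D(X) ⟺ D(X × (Z₁ × Z₂))`** (`standardConjectureD_tensor_tensor_iff`,
  `standardConjectureD_tensor_tensor_iff'`).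
* §3 (Galois side) **`Tᶜ(Z × X) ⟺ (Tᵖ(X) for all p + q = c with H^{2q}(Z) ≠ 0)`**
  (`tateConjectureFor_tensor_iff_left`) and the two-factor form for `(X × Z₁) × Z₂`
  (`tateConjectureFor_tensor_tensor_iff`).
* §4 (`k` finite, trace formula, `χ(φ_arith) = q`, RH for `𝐏ʳ`) **`D(𝐏ʳ × X) ⟺ D(X)`**
  (`standardConjectureD_projectiveSpace_tensor_iff`) and **`Tᶜ(𝐏ʳ × X) ⟺ (Tᵖ(X) for c − r ≤ p ≤ c)`**
  (`tateConjectureFor_projectiveSpace_tensor_iff`; row g53-#2 had the `⟸` half).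

HC is not touched; `D` and `T` stay open — only implications between their instances are proved.

## References

* [Kleiman1968AlgebraicCycles] S. Kleiman, *Algebraic cycles and the Weil conjectures* (1968), §1.2 (A)–(B),
  Prop. 1.2.4, §3 (`D(X)`, `D(X × Y) ⟹ D(X)`).
* [Kahn2020] B. Kahn, *Zeta and L-Functions of Varieties and Motives* (2020), §3.6 axiom (vi) (Künneth),
  §6.4 Prop. 6.11–6.12, §6.12.2.
* [Tate1994] J. Tate, *Conjectures on algebraic cycles in ℓ-adic cohomology* (1994), §1 (Conjecture `Tᵖ`).
* [Milne2007TateFiniteFieldsAIM] J. S. Milne, *The Tate conjecture over finite fields (AIM talk)*,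
  arXiv:0709.3040, §2 Cor. 2.2.
* [Fulton1998] W. Fulton, *Intersection Theory* (1998), Ex. 1.10.2.
* [Hartshorne1977] R. Hartshorne, *Algebraic Geometry* (1977), App. C Ex. 5.2.
* Tree: rows g53-#1 (`algebraicClasses_tensor_eq_top`), g53-#2 (`tateConjectureFor_tensor_iff`,
  `tateConjectureFor_tensor_comm`, `tateConjectureFor_tensor_projectiveSpace_iff`), g53-#7
  (`standardConjectureD_tensor_iff`); `StandardConjecturesDominatedVarieties`
  (`standardConjectureD_of_pullback_injective`); `KunnethFormulaBettiNumbers` (`finrank_obj_tensor_eq_zero_of_odd`);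
  `PreWeilCohomology` (`pullback_comp`, `pullback_id`).

## Provenance

Lane `lit-hodgefound` (summit `HodgeConjecture`, Track 2 foundations library, Layer B: motives — standard
conjectures and Tate's conjecture for products), seat `lit-hodgefound-p29` (literature-prover, generation 53,
row g53-#8).
-/

universe u v

open CategoryTheory AlgebraicGeometry MonoidalCategory CartesianMonoidalCategory

namespace Literature.AlgebraicGeometry.Motives

namespace WeilCohomology

variable {k : Type u} [Field k] {K : Type v} [Field K] [CharZero K] (W : WeilCohomology k K)
variable {n m m₁ m₂ : ℕ} {X Y Z Z₁ Z₂ : SchemeOver k}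

/-! ### §1 `D` along isomorphisms; `D(X × Z) ⟺ D(Z × X)`; `D(Z × X) ⟺ D(X)` -/

/-- **`D` is transported along an isomorphism `e : X ≅ Y`** of smooth projective varieties of the same
dimension: `e^*` is injective (`e⁻¹* ∘ e^* = id`), so Kleiman's descent of `D` along a morphism with injective
pull-back applies (with relative dimension `0`). [cite: Kleiman1968AlgebraicCycles, §3] -/
theorem standardConjectureD_of_iso (e : X ≅ Y) (hX : IsSmoothProjective n X) (hY : IsSmoothProjective n Y)
    (hD : W.StandardConjectureD n X) : W.StandardConjectureD n Y :=
  W.standardConjectureD_of_pullback_injective hX hY e.hom (r := 0) (Nat.add_zero n)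
    (fun p ↦ Function.LeftInverse.injective (g := W.pullback e.inv (2 * p)) fun y ↦ by
      rw [← LinearMap.comp_apply, ← W.pullback_comp, Iso.inv_hom_id, W.pullback_id, LinearMap.id_apply])
    hD

/-- **`D(X) ⟺ D(Y)` for isomorphic `X ≅ Y`.** [cite: Kleiman1968AlgebraicCycles, §3] -/
theorem standardConjectureD_iff_of_iso (e : X ≅ Y) (hX : IsSmoothProjective n X)
    (hY : IsSmoothProjective n Y) : W.StandardConjectureD n X ↔ W.StandardConjectureD n Y :=
  ⟨W.standardConjectureD_of_iso e hX hY, W.standardConjectureD_of_iso e.symm hY hX⟩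

/-- **`D(X × Z) ⟺ D(Z × X)`** (the braiding `X × Z ≅ Z × X`). [cite: Kleiman1968AlgebraicCycles, §3 and §1.2 Prop. 1.2.4] -/
theorem standardConjectureD_tensor_comm (hX : IsSmoothProjective n X) (hZ : IsSmoothProjective m Z) :
    W.StandardConjectureD (n + m) (X ⊗ Z) ↔ W.StandardConjectureD (m + n) (Z ⊗ X) := by
  have hZX : IsSmoothProjective (n + m) (Z ⊗ X) := by
    rw [Nat.add_comm]; exact IsSmoothProjective.tensor_holds hZ hX
  rw [Nat.add_comm m n]
  exact W.standardConjectureD_iff_of_iso (β_ X Z) (IsSmoothProjective.tensor_holds hX hZ) hZX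

/-- **`D(Z × X) ⟺ D(X)` for a left-hand factor `Z` with fully algebraic cohomology** (`K·A^q(Z) = H^{2q}(Z)`
for all `q`, `b_{odd}(Z) = 0`), from row g53-#7's `D(X × Z) ⟺ D(X)` and the braiding.
[cite: Kleiman1968AlgebraicCycles, §3] [cite: Kahn2020, §6.4 Prop. 6.11–6.12 and §6.12.2] -/
theorem standardConjectureD_tensor_iff_left (hZ : IsSmoothProjective m Z) (hX : IsSmoothProjective n X)
    (hZalg : ∀ q, W.algebraicClasses Z q = ⊤) (hZodd : ∀ j, Odd j → Module.finrank K (W.obj Z j) = 0) :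
    W.StandardConjectureD (m + n) (Z ⊗ X) ↔ W.StandardConjectureD n X :=
  (W.standardConjectureD_tensor_comm hX hZ).symm.trans (W.standardConjectureD_tensor_iff hX hZ hZalg hZodd)

/-! ### §2 Iterated products -/

/-- **`D((X × Z₁) × Z₂) ⟺ D(X)`** for two factors with fully algebraic cohomology (row g53-#7 twice).
[cite: Kleiman1968AlgebraicCycles, §3] [cite: Kahn2020, §6.4 Prop. 6.11–6.12 and §6.12.2] [cite: Fulton1998, Ex. 1.10.2] -/
theorem standardConjectureD_tensor_tensor_iff (hX : IsSmoothProjective n X) (hZ₁ : IsSmoothProjective m₁ Z₁)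
    (hZ₂ : IsSmoothProjective m₂ Z₂) (hZ₁alg : ∀ q, W.algebraicClasses Z₁ q = ⊤)
    (hZ₁odd : ∀ j, Odd j → Module.finrank K (W.obj Z₁ j) = 0) (hZ₂alg : ∀ q, W.algebraicClasses Z₂ q = ⊤)
    (hZ₂odd : ∀ j, Odd j → Module.finrank K (W.obj Z₂ j) = 0) :
    W.StandardConjectureD (n + m₁ + m₂) ((X ⊗ Z₁) ⊗ Z₂) ↔ W.StandardConjectureD n X :=
  (W.standardConjectureD_tensor_iff (IsSmoothProjective.tensor_holds hX hZ₁) hZ₂ hZ₂alg hZ₂odd).trans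
    (W.standardConjectureD_tensor_iff hX hZ₁ hZ₁alg hZ₁odd)

/-- **`D(X × (Z₁ × Z₂)) ⟺ D(X)`**: `Z₁ × Z₂` again has fully algebraic cohomology and no odd cohomology
(row g53-#1 `algebraicClasses_tensor_eq_top`, `finrank_obj_tensor_eq_zero_of_odd`).
[cite: Kleiman1968AlgebraicCycles, §3 and §1.2 (B)] [cite: Kahn2020, §3.6 axiom (vi) and §6.4 Prop. 6.11–6.12]
[cite: Fulton1998, Ex. 1.10.2] -/
theorem standardConjectureD_tensor_tensor_iff' (hX : IsSmoothProjective n X) (hZ₁ : IsSmoothProjective m₁ Z₁)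
    (hZ₂ : IsSmoothProjective m₂ Z₂) (hZ₁alg : ∀ q, W.algebraicClasses Z₁ q = ⊤)
    (hZ₁odd : ∀ j, Odd j → Module.finrank K (W.obj Z₁ j) = 0) (hZ₂alg : ∀ q, W.algebraicClasses Z₂ q = ⊤)
    (hZ₂odd : ∀ j, Odd j → Module.finrank K (W.obj Z₂ j) = 0) :
    W.StandardConjectureD (n + (m₁ + m₂)) (X ⊗ (Z₁ ⊗ Z₂)) ↔ W.StandardConjectureD n X :=
  W.standardConjectureD_tensor_iff hX (IsSmoothProjective.tensor_holds hZ₁ hZ₂)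
    (W.algebraicClasses_tensor_eq_top hZ₁ hZ₂ hZ₁alg hZ₂alg hZ₂odd)
    (fun _ hj ↦ W.finrank_obj_tensor_eq_zero_of_odd hZ₁ hZ₂ hZ₁odd hZ₂odd hj)

end WeilCohomology

namespace GaloisWeilCohomology

variable {k : Type u} [Field k] {K : Type v} [Field K] [CharZero K]
  {χ : Field.absoluteGaloisGroup k →* Kˣ} (E : GaloisWeilCohomology k K χ)
variable {n m m₁ m₂ : ℕ} {X Z Z₁ Z₂ : SchemeOver k}

/-! ### §3 Tate's conjecture with the fully algebraic factor on the left, and for two factors -/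

/-- **`Tᶜ(Z × X) ⟺ (Tᵖ(X) for every p + q = c with H^{2q}(Z) ≠ 0)`** for a left-hand factor `Z` with
fully algebraic cohomology (row g53-#2's `tateConjectureFor_tensor_iff` and the braiding
`tateConjectureFor_tensor_comm`). [cite: Tate1994, §1 (Conjecture Tᵖ)] [cite: Milne2007TateFiniteFieldsAIM, Cor. 2.2]
[cite: Kleiman1968AlgebraicCycles, §1.2 Prop. 1.2.4] -/
theorem tateConjectureFor_tensor_iff_left (hZ : IsSmoothProjective m Z) (hX : IsSmoothProjective n X)
    (hZalg : ∀ q, E.algebraicClasses Z q = ⊤) (hZodd : ∀ j, Odd j → Module.finrank K (E.obj Z j) = 0)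
    (c : ℕ) :
    E.TateConjectureFor (Z ⊗ X) c ↔
      ∀ p q : ℕ, p + q = c → Nontrivial (E.obj Z (2 * q)) → E.TateConjectureFor X p :=
  ⟨fun hT ↦ (E.tateConjectureFor_tensor_iff hX hZ hZalg hZodd c).mp (E.tateConjectureFor_tensor_comm hZ hX hT),
    fun h ↦ E.tateConjectureFor_tensor_comm hX hZ ((E.tateConjectureFor_tensor_iff hX hZ hZalg hZodd c).mpr h)⟩

/-- **`Tᶜ((X × Z₁) × Z₂)` iff `T^{p′}(X)` for every `p′ + q₁ + q₂ = c` with `H^{2q₁}(Z₁) ≠ 0`,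
`H^{2q₂}(Z₂) ≠ 0`** (row g53-#2 twice). [cite: Tate1994, §1 (Conjecture Tᵖ)] [cite: Milne2007TateFiniteFieldsAIM, Cor. 2.2] -/
theorem tateConjectureFor_tensor_tensor_iff (hX : IsSmoothProjective n X) (hZ₁ : IsSmoothProjective m₁ Z₁)
    (hZ₂ : IsSmoothProjective m₂ Z₂) (hZ₁alg : ∀ q, E.algebraicClasses Z₁ q = ⊤)
    (hZ₁odd : ∀ j, Odd j → Module.finrank K (E.obj Z₁ j) = 0) (hZ₂alg : ∀ q, E.algebraicClasses Z₂ q = ⊤)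
    (hZ₂odd : ∀ j, Odd j → Module.finrank K (E.obj Z₂ j) = 0) (c : ℕ) :
    E.TateConjectureFor ((X ⊗ Z₁) ⊗ Z₂) c ↔
      ∀ p q₂ : ℕ, p + q₂ = c → Nontrivial (E.obj Z₂ (2 * q₂)) →
        ∀ p' q₁ : ℕ, p' + q₁ = p → Nontrivial (E.obj Z₁ (2 * q₁)) → E.TateConjectureFor X p' := by
  rw [E.tateConjectureFor_tensor_iff (IsSmoothProjective.tensor_holds hX hZ₁) hZ₂ hZ₂alg hZ₂odd c]
  simp only [E.tateConjectureFor_tensor_iff hX hZ₁ hZ₁alg hZ₁odd]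

/-! ### §4 `Z = 𝐏ʳ` on the left, over a finite field -/

section ProjectiveSpace

variable [Finite k] {r : ℕ}

/-- **`D(𝐏ʳ × X) ⟺ D(X)`** over a finite field (trace formula, `χ(φ_arith) = q`, RH for `𝐏ʳ`).
[cite: Kleiman1968AlgebraicCycles, §3] [cite: Kahn2020, §6.4 Prop. 6.11 (6.4.1)–Prop. 6.12] [cite: Hartshorne1977, App. C Ex. 5.2] -/
theorem standardConjectureD_projectiveSpace_tensor_iff (hE : E.HasLefschetzTraceFormula)
    (hχ : ((χ (arithFrob k) : Kˣ) : K) = Nat.card k) (hRH : E.WeilRiemannHypothesisFor (projectiveSpace r k) r)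
    (hX : IsSmoothProjective n X) :
    E.StandardConjectureD (r + n) (projectiveSpace r k ⊗ X) ↔ E.StandardConjectureD n X :=
  E.standardConjectureD_tensor_iff_left (isSmoothProjective_projectiveSpace_holds k r) hX
    (E.algebraicClasses_projectiveSpace_eq_top hE hχ hRH) (fun _ hj ↦ E.finrank_projectiveSpace_of_odd hE hχ hRH hj)

/-- **`Tᶜ(𝐏ʳ × X) ⟺ (Tᵖ(X) for every c − r ≤ p ≤ c)`** over a finite field (row g53-#2 proved `⟸`,
`tateConjectureFor_projectiveSpace_tensor`). [cite: Milne2007TateFiniteFieldsAIM, Cor. 2.2] [cite: Tate1994, §1 (Conjecture Tᵖ)]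
[cite: Hartshorne1977, App. C Ex. 5.2] -/
theorem tateConjectureFor_projectiveSpace_tensor_iff (hE : E.HasLefschetzTraceFormula)
    (hχ : ((χ (arithFrob k) : Kˣ) : K) = Nat.card k) (hRH : E.WeilRiemannHypothesisFor (projectiveSpace r k) r)
    (hX : IsSmoothProjective n X) (c : ℕ) :
    E.TateConjectureFor (projectiveSpace r k ⊗ X) c ↔ ∀ p q : ℕ, p + q = c → q ≤ r → E.TateConjectureFor X p :=
  have hP := isSmoothProjective_projectiveSpace_holds k r
  ⟨fun hT ↦ (E.tateConjectureFor_tensor_projectiveSpace_iff hE hχ hRH hX c).mp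
      (E.tateConjectureFor_tensor_comm hP hX hT),
    fun h ↦ E.tateConjectureFor_tensor_comm hX hP
      ((E.tateConjectureFor_tensor_projectiveSpace_iff hE hχ hRH hX c).mpr h)⟩

/-- **`D(𝐏ᵃ × (𝐏ᵇ × 𝐏ʳ))`** over a finite field (RH for the three factors).
[cite: Kleiman1968AlgebraicCycles, §3] [cite: Hartshorne1977, App. C Ex. 5.2] -/
theorem standardConjectureD_projectiveSpace_tensor_projectiveSpace_tensor_projectiveSpace
    (hE : E.HasLefschetzTraceFormula) (hχ : ((χ (arithFrob k) : Kˣ) : K) = Nat.card k) {a b : ℕ}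
    (hRHa : E.WeilRiemannHypothesisFor (projectiveSpace a k) a)
    (hRHb : E.WeilRiemannHypothesisFor (projectiveSpace b k) b)
    (hRH : E.WeilRiemannHypothesisFor (projectiveSpace r k) r) :
    E.StandardConjectureD (a + (b + r)) (projectiveSpace a k ⊗ (projectiveSpace b k ⊗ projectiveSpace r k)) :=
  (E.standardConjectureD_tensor_tensor_iff' (isSmoothProjective_projectiveSpace_holds k a)
    (isSmoothProjective_projectiveSpace_holds k b) (isSmoothProjective_projectiveSpace_holds k r)
    (E.algebraicClasses_projectiveSpace_eq_top hE hχ hRHb) (fun _ hj ↦ E.finrank_projectiveSpace_of_odd hE hχ hRHb hj)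
    (E.algebraicClasses_projectiveSpace_eq_top hE hχ hRH) (fun _ hj ↦ E.finrank_projectiveSpace_of_odd hE hχ hRH hj)).mpr
    (E.standardConjectureD_projectiveSpace hE hχ hRHa)

end ProjectiveSpace

end GaloisWeilCohomology

end Literature.AlgebraicGeometry.Motives
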